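import Mathlib
import HarnessLib
import Summits.NavierStokesRegularity.NavierStokesRegularity.Theorems.TypeILiouvilleLambTailVorticityFloor

/-!
# TypeILiouvilleLambTailFloor — crux (L) stmt-NavierStokesRegularity-10661 `TypeIliouvilleL`:
# LAMB TAILS WHOSE PRIMITIVE IS `o(1/((−t) log(−t)))` ARE TRIVIAL (part 12 of `TypeILiouvilleLambTail`)

Helper for stmt-NavierStokesRegularity-10661 (`--supports`); theorems only, no definitions, no named-fact
hypotheses; closes no item; Navier–Stokes regularity is NOT proved here (leafhand seat of the EulerZoomLiouville route).

Class P, `ω = curl v`, vortex commutator `f = Dv[ω] − Dω[v] = curl(v × ω)`.  The Lamb-tail budget (part 2,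
`norm_curl_le_integral_Iic_of_commutator_majorant`: `‖ω(t,x)‖ ≤ Φ(t) := ∫_{(−∞,t]} φ` for any continuous majorant `φ` of
`f`) composed with the vorticity floor of part 11 (`const_of_vorticity_littleO_log`):

* `const_of_commutator_tail_littleO_log` — ★★ **if the primitive of a Lamb-tail majorant is `o(1/((−t) log(−t)))`,
  i.e. `Φ(t) ≤ h(t)` on a far past with `(−t)(1 + log(−t)) h(t) → 0`, the flow is ONE CONSTANT VECTOR.**  Contains
  part 9's `p > 2` cell (`Φ ≍ (−t)^{1−p}`) and e.g. the tails `φ ≤ A (−t)^{−2} (log(−t))^{−q}`, `q > 1`.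
  READING: on the Lamb-tail axis the residual of (L) is now exactly the tails whose primitive is NOT
  `o(1/((−t) log(−t)))` — at and below the scale-invariant rate `curl(v × ω) ≍ (−t)^{−2}` up to one logarithm —
  all of them quiescent when summable (part 2).

HONEST LABEL: classical estimates; nothing here proves a registered stub, (L), or NS regularity; rung 0.
[cite: KochNadirashviliSereginSverak2009, §4 (i), Lemma 6.1 (arXiv:0709.3599)] [cite: MajdaBertozziCUP2002, §3.3 Prop. 3.8 (3.87), eq. (3.80)]
-/

noncomputable section
open MeasureTheory Filter Set Function Metric
open scoped Topology ENNReal NNReal RealInnerProductSpace Laplacian ContDiff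
open Literature.Analysis Literature.Analysis.FluidPDE Literature.Analysis.UnboundedOperators
set_option linter.dupNamespace false
namespace Summit.NavierStokesRegularity.NavierStokesRegularity.Theorems.TypeILiouvilleLambTail

/-- ★★ **LAMB TAILS WITH PRIMITIVE `o(1/((−t) log(−t)))` ⟹ ONE CONSTANT VECTOR (unconditional).**  Let `φ` be a
continuous majorant of the vortex commutator `‖Dv[ω] − Dω[v]‖(τ,·)` on `(−∞,0)`, integrable on every `(−∞,t]`, `t < 0`,
and suppose `∫_{(−∞,t]} φ ≤ h(t) ≤ 1`, `h(t) > 0` for `t < T₀` with `(−t)(1 + log(−t)) h(t) → 0` as `t → −∞`.  Then the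
class-P flow is constant (budget of part 2 + vorticity floor of part 11).
[cite: KochNadirashviliSereginSverak2009, §4 (i) (arXiv:0709.3599)] [cite: MajdaBertozziCUP2002, §3.3 Prop. 3.8 (3.87), eq. (3.80)] -/
theorem const_of_commutator_tail_littleO_log
    {v : ℝ → EuclideanSpace ℝ (Fin 3) → EuclideanSpace ℝ (Fin 3)}
    (hc : ContinuousOn (uncurry v) (Iio 0 ×ˢ univ))
    (hK : ∃ K : ℝ, ∀ t < 0, ∀ x, ‖v t x‖ ≤ K)
    (hd : ∀ t < 0, IsWeaklyDivFree (v t))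
    (hm : ∀ s t : ℝ, s < t → t < 0 → ∀ x,
      v t x = heatExtension (v s) (t - s) x - oseenDuhamel 1 s v v t x)
    {φ : ℝ → ℝ} (hφc : Continuous φ)
    (hφ : ∀ τ < 0, ∀ x : EuclideanSpace ℝ (Fin 3),
      ‖fderiv ℝ (v τ) x (curl (v τ) x) - fderiv ℝ (curl (v τ)) x (v τ x)‖ ≤ φ τ)
    (hint : ∀ t < 0, IntegrableOn φ (Iic t))
    {h : ℝ → ℝ} {T₀ : ℝ} (hT₀ : T₀ < 0) (hh0 : ∀ t < T₀, 0 < h t) (hh1 : ∀ t < T₀, h t ≤ 1)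
    (hΦ : ∀ t < T₀, ∫ τ in Iic t, φ τ ≤ h t)
    (hlim : Tendsto (fun t : ℝ => (-t) * (1 + Real.log (-t)) * h t) atBot (𝓝 0)) :
    ∃ b : EuclideanSpace ℝ (Fin 3), ∀ t < 0, ∀ x, v t x = b :=
  const_of_vorticity_littleO_log hc hK hd hm hT₀ hh0 hh1
    (fun t ht x => (norm_curl_le_integral_Iic_of_commutator_majorant hc hK hd hm hφc hφ (ht.trans hT₀)
      (hint t (ht.trans hT₀)) x).trans (hΦ t ht)) hlim

/-- The same with the hypothesis on the CURL OF THE LAMB VECTOR `‖curl(v × curl v)(τ,x)‖ ≤ φ(τ)`.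
[cite: MajdaBertozziCUP2002, §1.1, §2.3] [cite: KochNadirashviliSereginSverak2009, §4 (i) (arXiv:0709.3599)] -/
theorem const_of_lambCurl_tail_littleO_log
    {v : ℝ → EuclideanSpace ℝ (Fin 3) → EuclideanSpace ℝ (Fin 3)}
    (hc : ContinuousOn (uncurry v) (Iio 0 ×ˢ univ))
    (hK : ∃ K : ℝ, ∀ t < 0, ∀ x, ‖v t x‖ ≤ K)
    (hd : ∀ t < 0, IsWeaklyDivFree (v t))
    (hm : ∀ s t : ℝ, s < t → t < 0 → ∀ x,
      v t x = heatExtension (v s) (t - s) x - oseenDuhamel 1 s v v t x)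
    {φ : ℝ → ℝ} (hφc : Continuous φ)
    (hlamb : ∀ τ < 0, ∀ x : EuclideanSpace ℝ (Fin 3), ‖curl (fun y => cross (v τ y) (curl (v τ) y)) x‖ ≤ φ τ)
    (hint : ∀ t < 0, IntegrableOn φ (Iic t))
    {h : ℝ → ℝ} {T₀ : ℝ} (hT₀ : T₀ < 0) (hh0 : ∀ t < T₀, 0 < h t) (hh1 : ∀ t < T₀, h t ≤ 1)
    (hΦ : ∀ t < T₀, ∫ τ in Iic t, φ τ ≤ h t)
    (hlim : Tendsto (fun t : ℝ => (-t) * (1 + Real.log (-t)) * h t) atBot (𝓝 0)) :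
    ∃ b : EuclideanSpace ℝ (Fin 3), ∀ t < 0, ∀ x, v t x = b := by
  obtain ⟨K, hKb⟩ := hK
  obtain ⟨hsm', -⟩ := smooth_and_bounds_of_bounded_ancient_oseenMild hc hd hm hKb
  have hsm : IsSmoothSpaceTimeOn (Iio 0) v := hsm'
  have hslice : ∀ τ < 0, ContDiff ℝ 2 (v τ) := fun τ hτ =>
    (hsm.contDiff_slice (mem_Iio.2 hτ)).of_le (by norm_cast)
  have hdiv' : ∀ τ < 0, VectorCalculus.IsDivFree (v τ) := fun τ hτ =>
    (hd τ hτ).isDivFree_of_contDiff ((hslice τ hτ).of_le (by norm_num))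
  refine const_of_commutator_tail_littleO_log hc ⟨K, hKb⟩ hd hm hφc (fun τ hτ x => ?_) hint hT₀ hh0 hh1 hΦ hlim
  rw [← TypeILiouvilleGeneralizedBeltrami.curl_lamb_eq_sub (hslice τ hτ) (hdiv' τ hτ) x]
  exact hlamb τ hτ x

end Summit.NavierStokesRegularity.NavierStokesRegularity.Theorems.TypeILiouvilleLambTail

end
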